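import Mathlib
import Summits.ResolutionOfSingularities.ResolutionOfSingularities.Theorems.WeightedInvariantLocalWeightedDropTameN4RelativeLift
import Summits.ResolutionOfSingularities.ResolutionOfSingularities.Theorems.WeightedInvariantLocalWeightedDropTupleDropAssembly
import Summits.ResolutionOfSingularities.ResolutionOfSingularities.Theorems.WeightedInvariantLocalWeightedDropMonomialPhase
import Summits.ResolutionOfSingularities.ResolutionOfSingularities.Theorems.WeightedInvariantLocalWeightedDropSpaceCountGame
import Summits.ResolutionOfSingularities.ResolutionOfSingularities.Theorems.WeightedInvariantLocalWeightedDropSpaceNCCountOfCJSB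

/-!
# `WeightedInvariant.LocalWeightedDrop`, residual T″|₄ `stub_tameWideApexFourStartsWon` (skeleton v31): PER-GERM finite NC-winnability of
# the support product wins the prepared germ — the relative assembly (F-A) and the relative tame-multiplicity lift applied (F-C)

Crux item stmt-ResolutionOfSingularities-8899 `LocalWeightedDrop` (route `ResolutionOfSingularities/WeightedInvariant`), engine skeleton v31
(fb48e93459d3708f), residual T″|₄.  [OURS · L1 W4.3, chain w43, res-L1-w43-stub-1 (gen 4), option (K-b) of
`L/res-L1-w43-stub-1/N4-TAME-CENSUS.md` v1.1 / `KB-DESIGN.md` files F-A + F-C; F-B = `…TameN4RelativeLift` (`TameN4.multiplicityLift_rel`).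
Inputs (all landed): res-type-088's assembly tools `TupleDropAssembly.*` (p501911: `subst_chart_subst_prodSupport`, `prodSupport_newTuple_dvd`,
`slice_ne_zero`, `mul_add_lt_of_lt`), the dimension-generic monomial phase `TameFourTupleDrop.germMonomialPhase` (…MonomialPhase), the count
game `TameFourTupleDrop.WinsIn` with `winsIn_of_dvd_pow` (…SpaceCountGame) and NC-heredity `germIsNC_of_dvd_pow` (…SpaceNCCountOfCJSB, fact-free
part).  Nothing here is a statement of any manuscript; the games are OURS.]

THE POINT.  The landed chain `TameLift.preparedWon_of_drop` ∘ `tupleDrop_of_tot_of_mono` needs the GLOBAL totality (TOT_m) «every non-zero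
germ is finitely NC-winnable» (= ⟨F-32bR⟩ at m + 1 = 3); its assembly `tupleDrop_of_count_of_monomialPhase` cannot be fed a per-germ depth
(the heredity clause of a global count crosses the finite/non-finite boundary).  Here the same argument is run RELATIVE to the class
`FinNC b :≡ ∃ n, WinsIn GermIsNC n b` of finitely NC-winnable germs, which is closed under divisors of powers and under the count's own moves:
* `TameN4.stepDrop_of_winsIn` (F-A) — a rank `κ a := ω^ω?`… precisely `κ a := β · depth (prodSupport a) + μ a` (`depth` = least number of
  rounds, `μ < β` the monomial-phase rank) with `StepDrop κ (FinNC ∘ prodSupport)` at EVERY non-zero bad tuple whose support product is in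
  `FinNC`;
* `TameN4.preparedWon_of_winsIn` (F-C) — with F-B: over a field of characteristic `p` with `p ∤ e + 2`, if the singular germs of order `< e + 2`
  in `m + 2` variables are won, then the prepared germ `U · y^{e+2} + Σ a_j y^j` of every non-zero bad tuple `a` on `k⟦x₀,…,x_m⟧` whose support
  product `∏_{a_j ≠ 0} a_j` is FINITELY NC-WINNABLE is `Won` — no global (TOT_m) needed.  At m + 1 = 3 this turns every landed TOT₂ class
  (cylinders over plane curves, products, arrangements — …NCProduct*; Newton-non-degenerate germs once R6 lands) into N = 4 TAME wins of every
  multiplicity `e + 2`, beyond the divisors-of-powers reached by `NCTransport.won_of_winsIn`.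
AI-written; gate-accepted means sorry-free with standard axioms, not refereed.
-/

set_option linter.dupNamespace false -- mandated namespace of this single-conjunct summit

namespace Summit.ResolutionOfSingularities.ResolutionOfSingularities.Theorems

open Literature.AlgebraicGeometry.Resolution
open Literature.AlgebraicGeometry.Resolution.CobordantGame

namespace TameN4

open MvPowerSeries TupleDropAssembly TameFourTupleDrop

variable {k : Type} [Field k] {m : ℕ}

/-! ### The depth `sInf {n : ℕ | WinsIn GermIsNC n b}` of a finitely NC-winnable germ (no definition is introduced) -/

/-- A finitely winnable germ is won within its depth. -/
theorem winsIn_sInf {b : MvPowerSeries (Fin (m + 1)) k} (h : ∃ n, WinsIn GermIsNC n b) : WinsIn GermIsNC (sInf {n : ℕ | WinsIn GermIsNC n b}) b :=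
  Nat.sInf_mem h

/-- The depth is at most any number of rounds that wins. -/
theorem sInf_winsIn_le {b : MvPowerSeries (Fin (m + 1)) k} {n : ℕ} (h : WinsIn GermIsNC n b) : sInf {n : ℕ | WinsIn GermIsNC n b} ≤ n := Nat.sInf_le h

/-- The class of finitely NC-winnable germs is closed under divisors of powers, with non-increasing depth. -/
theorem sInf_winsIn_le_of_dvd_pow {b d : MvPowerSeries (Fin (m + 1)) k} (hd : d ≠ 0) (hfin : ∃ n, WinsIn GermIsNC n d) (N : ℕ)
    (hdvd : b ∣ d ^ (N + 1)) : (∃ n, WinsIn GermIsNC n b) ∧ sInf {n : ℕ | WinsIn GermIsNC n b} ≤ sInf {n : ℕ | WinsIn GermIsNC n d} := by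
  have h := winsIn_of_dvd_pow (m := m) (P := GermIsNC) (fun N b d hd hnc hdvd => germIsNC_of_dvd_pow N b d hd hnc hdvd)
    (sInf {n : ℕ | WinsIn GermIsNC n d}) N b d hd (winsIn_sInf hfin) hdvd
  exact ⟨⟨_, h⟩, sInf_winsIn_le h⟩

/-- Depth `0` is normal crossings. -/
theorem sInf_winsIn_eq_zero_of_germIsNC {b : MvPowerSeries (Fin (m + 1)) k} (h : GermIsNC b) : sInf {n : ℕ | WinsIn GermIsNC n b} = 0 :=
  Nat.le_zero.mp (sInf_winsIn_le ((winsIn_zero GermIsNC b).mpr h))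

/-- A finitely winnable germ that is NOT normal crossings has positive depth, and the count's move of a winning line drops the depth at
every answer: the `MoveClause` of round `depth − 1`. -/
theorem exists_move_of_not_germIsNC {b : MvPowerSeries (Fin (m + 1)) k} (hfin : ∃ n, WinsIn GermIsNC n b) (hnc : ¬ GermIsNC b) :
    ∃ d : ℕ, sInf {n : ℕ | WinsIn GermIsNC n b} = d + 1 ∧ ∃ (Φ : Fin (m + 1) → MvPowerSeries (Fin (m + 1)) k) (w : Fin (m + 1) → ℕ),
      IsCountMove Φ w ∧ MoveClause b Φ w (WinsIn GermIsNC d) := by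
  have hD := winsIn_sInf hfin
  rcases hdepth : sInf {n : ℕ | WinsIn GermIsNC n b} with _ | d
  · rw [hdepth, winsIn_zero] at hD
    exact absurd hD hnc
  · refine ⟨d, rfl, ?_⟩
    rw [hdepth, winsIn_succ] at hD
    rcases hD with hless | ⟨Φ, w, hmv, hcl⟩
    · exact absurd (sInf_winsIn_le hless) (by rw [hdepth]; omega)
    · exact ⟨Φ, w, hmv, hcl⟩

/-! ### F-A: the relative assembly -/

/-- **`StepDrop` ON THE CLASS OF TUPLES WITH FINITELY NC-WINNABLE SUPPORT PRODUCT** (relative form of res-type-088's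
`tupleDrop_of_count_of_monomialPhase`): for every number `m + 1` of variables and every `e` there is a rank `κ` such that every non-zero bad
tuple whose support product is finitely NC-winnable has a move after which, at every bad non-zero successor, the support product is again finitely
NC-winnable and `κ` has dropped.  Rank: `β · depth (prodSupport a) + μ a` with `μ < β` the monomial-phase rank (`germMonomialPhase`). -/
theorem stepDrop_of_winsIn (m e : ℕ) :
    ∃ κ : (Fin (e + 1) → MvPowerSeries (Fin (m + 1)) k) → Ordinal.{0},
      ∀ a : Fin (e + 1) → MvPowerSeries (Fin (m + 1)) k, a ≠ 0 → TupleGame.Bad a →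
        (∃ n, WinsIn GermIsNC n (TupleGame.prodSupport a)) →
        TupleGame.StepDrop κ (fun b => ∃ n, WinsIn GermIsNC n (TupleGame.prodSupport b)) a := by
  classical
  obtain ⟨β, μ, hμlt, hμstep⟩ := germMonomialPhase k m e
  refine ⟨fun a => β * ((sInf {n : ℕ | WinsIn GermIsNC n (TupleGame.prodSupport a)} : ℕ) : Ordinal.{0}) + μ a, ?_⟩
  intro a ha hbad hfin
  by_cases hP : GermIsNC (TupleGame.prodSupport a)
  · -- normal-crossing support product: the monomial phase's move; depth stays `0`, `μ` drops
    obtain ⟨Φ, w, hΦ0, hdet, hw1, hwpos, hstep⟩ := hμstep a ha hbad hP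
    refine ⟨Φ, w, hΦ0, hdet, hw1, hwpos, ?_⟩
    intro c hc hc0 D G hfac
    obtain ⟨i, hci, hi⟩ := hstep c hc hc0 D G hfac
    refine ⟨i, hci, fun hne hbad' => ?_⟩
    obtain ⟨hPnew, hμlt'⟩ := hi hne hbad'
    refine ⟨⟨0, (winsIn_zero GermIsNC _).mpr hPnew⟩, ?_⟩
    dsimp only
    rw [sInf_winsIn_eq_zero_of_germIsNC hPnew, sInf_winsIn_eq_zero_of_germIsNC hP]
    exact (add_lt_add_iff_left _).mpr hμlt'
  · -- support product not yet NC: the count's move of a shortest winning line; the depth drops at every answer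
    obtain ⟨d, hdepth, Φ, w, ⟨hΦ0, hdet, hw1, hwpos⟩, hmove⟩ := exists_move_of_not_germIsNC hfin hP
    refine ⟨Φ, w, hΦ0, hdet, hw1, hwpos, ?_⟩
    intro c hc hc0 D G hfac
    obtain ⟨hprod, hndvd⟩ := subst_chart_subst_prodSupport a Φ hΦ0 w c hc D G hfac
    obtain ⟨i, hci, hwin⟩ := hmove c hc hc0 _ _ hprod hndvd
    have hne : X 0 * TupleGame.slice i (∏ j, if a j = 0 then (1 : MvPowerSeries (Fin (m + 1 + 1)) k) else G j) ≠ 0 :=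
      mul_ne_zero (MvPowerSeries.prime_X' k (0 : Fin (m + 1))).ne_zero (slice_ne_zero _ w c hc hw1 _ _ hprod hndvd i hci)
    obtain ⟨hfin', hle⟩ := sInf_winsIn_le_of_dvd_pow hne ⟨d, hwin⟩ _ (prodSupport_newTuple_dvd a D G i)
    refine ⟨i, hci, fun _ _ => ⟨hfin', ?_⟩⟩
    have hlt : sInf {n : ℕ | WinsIn GermIsNC n (TupleGame.prodSupport (TupleGame.newTuple a D G i))} < sInf {n : ℕ | WinsIn GermIsNC n (TupleGame.prodSupport a)} := by
      rw [hdepth]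
      exact Nat.lt_succ_of_le (hle.trans (sInf_winsIn_le hwin))
    exact mul_add_lt_of_lt _ (hμlt _) hlt

/-! ### F-C: the prepared germ of a tuple with finitely NC-winnable support product is won -/

/-- **PER-GERM (TOT) ⇒ THE PREPARED GERM IS WON** (every number `m + 1` of coefficient variables, multiplicity `e + 2` invertible in `k`):
if the singular germs of order `< e + 2` in `m + 2` variables are won, then for every unit `U` and every non-zero bad tuple `a` on
`k⟦x₀,…,x_m⟧` whose support product is finitely NC-winnable, `U · y^{e+2} + Σ a_j y^j` is `Won k (m + 2)`.  (F-A + F-B; at `m + 1 = 3` the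
multiplier of every TOT₂ class into the tame N = 4 residual.) -/
theorem preparedWon_of_winsIn (p : ℕ) (hp : p.Prime) [CharP k p] (m e : ℕ) (he : ((e + 2 : ℕ) : k) ≠ 0)
    (hlow : ∀ G : MvPowerSeries (Fin (m + 1 + 1)) k, IsSingular k G → G.order < ((e + 2 : ℕ) : ℕ∞) → Won k (m + 1 + 1) G)
    (U : MvPowerSeries (Fin (m + 1 + 1)) k) (a : Fin (e + 1) → MvPowerSeries (Fin (m + 1)) k) (hU : constantCoeff U ≠ 0)
    (ha : a ≠ 0) (hBad : TupleGame.Bad a) (hfin : ∃ n, WinsIn GermIsNC n (TupleGame.prodSupport a)) :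
    Won k (m + 1 + 1) (TupleGame.germ U a) := by
  obtain ⟨κ, hκ⟩ := stepDrop_of_winsIn (k := k) m e
  exact multiplicityLift_rel p hp k (m + 1) e he κ _ hκ hlow U a hU ha hBad hfin

/-- The same for a WHOLE tame germ in Tschirnhaus position is the corollary of `stub_tschirnhausForm`; here the dimension `m + 1 + 1 = 4`
reading for the census: a non-zero bad tuple `a` on `k⟦x₀,x₁,x₂⟧` with finitely NC-winnable support product gives a won prepared threefold
hypersurface germ, given the lower orders. -/
theorem preparedWon_four_of_winsIn (p : ℕ) (hp : p.Prime) [CharP k p] (e : ℕ) (he : ((e + 2 : ℕ) : k) ≠ 0)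
    (hlow : ∀ G : MvPowerSeries (Fin 4) k, IsSingular k G → G.order < ((e + 2 : ℕ) : ℕ∞) → Won k 4 G)
    (U : MvPowerSeries (Fin 4) k) (a : Fin (e + 1) → MvPowerSeries (Fin 3) k) (hU : constantCoeff U ≠ 0)
    (ha : a ≠ 0) (hBad : TupleGame.Bad a) (hfin : ∃ n, WinsIn (m := 2) GermIsNC n (TupleGame.prodSupport a)) :
    Won k 4 (TupleGame.germ U a) :=
  preparedWon_of_winsIn p hp 2 e he hlow U a hU ha hBad hfin

end TameN4

end Summit.ResolutionOfSingularities.ResolutionOfSingularities.Theorems
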